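import Summits.BirchSwinnertonDyer.BirchSwinnertonDyer.Theorems.EisensteinPrimesMazurMCOnCellBKernelCertP13NoUnitVertex
import Summits.BirchSwinnertonDyer.BirchSwinnertonDyer.Theorems.EisensteinPrimesMazurMCOnCellBKernelCertP13PredictedCell
import Summits.BirchSwinnertonDyer.BirchSwinnertonDyer.Theorems.EisensteinPrimesMazurMCOnCellBKernelCertP13ThirdCell
import Summits.BirchSwinnertonDyer.BirchSwinnertonDyer.Theorems.EisensteinPrimesMazurMCOnCellBKernelCertP13FourthCell
import Summits.BirchSwinnertonDyer.BirchSwinnertonDyer.Theorems.EisensteinPrimesMazurMCOnCellBKernelCertP13FifthCell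
import Summits.BirchSwinnertonDyer.BirchSwinnertonDyer.Theorems.EisensteinPrimesMazurMCOnCellBKernelCertP13SplitA10Cell
import Summits.BirchSwinnertonDyer.BirchSwinnertonDyer.Theorems.EisensteinPrimesMazurMCOnCellBKernelCertP13InertCell
import Summits.BirchSwinnertonDyer.BirchSwinnertonDyer.Theorems.EisensteinPrimesMazurMCOnCellBKernelCertP13TenthCell
import Summits.BirchSwinnertonDyer.BirchSwinnertonDyer.Theorems.EisensteinPrimesMazurMCOnCellBKernelCertP13EleventhCell
import Summits.BirchSwinnertonDyer.BirchSwinnertonDyer.Theorems.EisensteinPrimesMazurMCOnCellBKernelCertP13SeventhCell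
import Summits.BirchSwinnertonDyer.BirchSwinnertonDyer.Theorems.EisensteinPrimesMazurMCOnCellBKernelCertP13NinthCell
import Summits.BirchSwinnertonDyer.BirchSwinnertonDyer.Theorems.EisensteinPrimesMazurMCOnCellBKernelCertP13TwelfthCell
import Summits.BirchSwinnertonDyer.BirchSwinnertonDyer.Theorems.EisensteinPrimesMazurMCOnCellBKernelCertP13ThirteenthCell
import Summits.BirchSwinnertonDyer.BirchSwinnertonDyer.Theorems.EisensteinPrimesMazurMCOnCellBKernelCertP13DoorPrice
import Literature.NumberTheory.QuadraticFields.ImaginaryQuadraticPrescribedSplitting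
import Literature.NumberTheory.EllipticCurves.BurungaleSkinner2023.Curve14a1TwistsCertificate
import Literature.NumberTheory.EllipticCurves.NonEisensteinPrimeOfSurjective
import Literature.NumberTheory.EllipticCurves.KrizLi2019.ThreeClassNumbers
import Mathlib.Tactic.NormNum.LegendreSymbol
import HarnessLib

/-!
# Crux 3 `MazurMCOnCellB` (stmt-BirchSwinnertonDyer-19033) — the `p = 13` slice: DOOR PRICE, SHARP SIDE — at every A10-type cell at `13` on record (twelve cells: g19's, g20's eight,
# this seat's three) the LEAST admissible Heegner field EXISTS with `d_K = −B` exactly, IN THE KERNEL; so the bounds `d ≤ −B` of `…KernelCertP13DoorPrice` (p764408) /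
# `…DoorPriceII` are attained and the cheapest conceivable door datum of twistback's stub 6⁷ at each cell is an L-reading at conductor EXACTLY `N_E·B²`

Width seat bsd-line-x2-p1-w6 (gen 21), cell `bsd-eis` (run/shared/lean/pub/bsd-eis/), 2026-08-30; `--supports stmt-BirchSwinnertonDyer-19033 --as helper`.
THEOREMS ONLY (no `def`, no named fact, no `sorry`, no instance). Registered line `twistback` v13b is NOT touched; nothing here closes a stub.

WHAT. §0 generic: `mem_of_prime_dvd_prod_pow` (a prime dividing a product of prime powers is one of the bases), `dvd_Δ_of_dvd_conductorNorm` (primes of `N_W` divide `Δ(W₀)`: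
good reduction off `Δ`, `BurungaleSkinner2023.hasGoodReductionAtPrime_baseChange_int_of_not_dvd` + `not_dvd_conductorNorm_of_hasGoodReductionAtPrime`), and the engine `exists_heegnerField_of_check` (the quadratic field with `d_K = D` exists for a fundamental `D ≡ 1 (mod 4)` — `Quadratic.exists_numberField_discr_eq`; it is
imaginary quadratic (`isTotallyComplex_of_discr_neg`); Heegner for `N_W` because every prime of `N_W` lies in the certified prime-power factorisation of `Δ(W₀)` and every such prime
splits (`d ≡ 1 (mod 8)`; `jacobiSym D q = 1` ⇒ split, `Quadratic.ncard_primesOver_eq_two_iff_jacobiSym`)). §1: per cell (vertex `E`) `exists_heegnerField_discr_eq_<tag> :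
∃ K, IsImaginaryQuadratic K ∧ discr K = −B ∧ SatisfiesHeegnerHypothesis (E.conductorNorm ℤ) K ∧ SatisfiesHeegnerHypothesis 13 K ∧ Odd (discr K) ∧ discr K < −4` — EXACTLY the
field-side hypotheses `(K₀, hK, hHN, hHp, hodd, hlt)` of the order-one anchor door `…_of_orderOneAnchor_self` of the cell files and of a two-step edge `TwoStepAt 13 E _`; the
residue facts `jacobiSym (−B) q = 1` are evaluated by `norm_num`, the factorisation of `Δ` by `decide +kernel`. CELLS / B / conductor `N·B²`: g19 335 / 5.66e16 · A 2159 / 1.04e18 ·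
B 599 / 5.16e18 · C 2159 / 9.83e19 · D 1095 / 3.10e19 · S 103 / 9.10e14 · I 1223 / 1.11e20 · #7 103 / 6.55e17 · #9 2159 / 8.24e20 · #10 199 / 5.39e16 · #11 103 / 8.65e17 · #12 1167 / 8.60e19.
WHAT IS NOT CLAIMED: that the least field carries `r_an(E^{(−B)}) = 1` or a 13-adic order-one certificate (a reading nobody has made); a price for REVERSE first edges of the
zig-zag (field Heegner for the conductor of a twist of `E`; memo §1.5, numerics only); anything about L-values, Selmer groups, the main conjecture or BSD. HONEST FRAMING: elementary kernel facts about explicit equations and quadratic fields; the doors stay CONDITIONAL and un-instantiated; closes no registered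
stub; 0 cells / labels / stubs / tiers move; no summit statement, no case of Mazur's main conjecture and no case of BSD is proved for any curve. Memo of record:
`P13-DESCENT-ATLAS-w6g21.md` (evidence on -19033); mirror `HOME/line-x2-p1-w6-g21/`.
References: [GrossLMS1991] §1; [Darmon2004] Hyp. 3.9; [IrelandRosen1990] Prop. 13.1.3–13.1.4; [SilvermanAEC2009] VII.5 Prop. 5.1(a); [Marcus1977] Ch. 2 Thm. 1 (d_K of ℚ(√m));
this lane's `…KernelCertP13DoorPrice` (p764408).
-/

set_option autoImplicit false
-- `Summit.BirchSwinnertonDyer.BirchSwinnertonDyer.…`: the summit and its single sub-problem share a name.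
set_option linter.dupNamespace false

noncomputable section

open scoped Classical
open WeierstrassCurve NumberField Literature.NumberTheory.EllipticCurves
  Literature.NumberTheory.QuadraticFields
  Summit.BirchSwinnertonDyer.BirchSwinnertonDyer.Rank1Residual.X11RankOne
  Summit.BirchSwinnertonDyer.BirchSwinnertonDyer.Theorems
  Summit.BirchSwinnertonDyer.BirchSwinnertonDyer.Theorems.EisensteinPrimesMazurMCOnCellBKernelCertP13DoorPrice

namespace Summit.BirchSwinnertonDyer.BirchSwinnertonDyer.Theorems.EisensteinPrimesMazurMCOnCellBKernelCertP13DoorPriceSharp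

/-! ## §0 Generic (sharpness side): primes of the conductor lie in the factorisation of `Δ`; the least admissible field exists -/

/-- A prime dividing a product of prime powers is one of the bases. [folklore] -/
theorem mem_of_prime_dvd_prod_pow {p : ℕ} (hp : p.Prime) :
    ∀ l : List (ℕ × ℕ), (∀ qe ∈ l, qe.1.Prime) → p ∣ (l.map fun qe => qe.1 ^ qe.2).prod → p ∈ l.map Prod.fst
  | [], _, h => by simp at h; exact absurd (h ▸ hp) Nat.not_prime_one
  | (q, e) :: l, hl, h => by
    rw [List.map_cons, List.prod_cons] at h
    rcases (Nat.Prime.dvd_mul hp).mp h with h1 | h2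
    · have := (Nat.prime_dvd_prime_iff_eq hp (hl (q, e) (by simp))).mp (hp.dvd_of_dvd_pow h1)
      simp [this]
    · exact List.mem_cons_of_mem _ (by simpa using mem_of_prime_dvd_prod_pow hp l (fun qe hqe => hl qe (by simp [hqe])) h2)

/-- **Primes of the conductor divide the discriminant of an integer model** (good reduction off `Δ(W₀)`, Silverman AEC VII.5 Prop. 5.1(a); the conductor is supported on the
bad primes, ATAEC IV.10). [cite: SilvermanAEC2009, VII.5 Prop. 5.1(a)] -/
theorem dvd_Δ_of_dvd_conductorNorm (W₀ : WeierstrassCurve ℤ) {W : WeierstrassCurve ℚ} [W.IsElliptic]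
    (hW : W₀.baseChange ℚ = W) {p : ℕ} (hp : p.Prime) (h : p ∣ W.conductorNorm ℤ) : (p : ℤ) ∣ W₀.Δ := by
  subst hW
  by_contra hnd
  haveI : Fact p.Prime := ⟨hp⟩
  exact Literature.NumberTheory.EllipticCurves.not_dvd_conductorNorm_of_hasGoodReductionAtPrime _
    (Literature.NumberTheory.EllipticCurves.BurungaleSkinner2023.hasGoodReductionAtPrime_baseChange_int_of_not_dvd W₀ hnd) h

/-- **Sharpness engine.** For an elliptic `W = W₀ ⊗ ℚ` whose `Δ(W₀)` is `±` an explicit product of prime powers over a list `l` of primes containing `13`, and a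
fundamental discriminant `D ≡ 1 (mod 8)`, `D < −4`, with `(D / q) = 1` for every odd `q ∈ l`: the quadratic field `K` with `d_K = D` exists (`Quadratic.exists_numberField_discr_eq`),
is imaginary quadratic, and satisfies the Heegner hypothesis for `N_W` (every prime of `N_W` is in `l`, and every prime of `l` splits: decomposition law) and for `13`.
[cite: GrossLMS1991, §1 (p. 235)] [cite: IrelandRosen1990, Prop. 13.1.3–13.1.4] -/
theorem exists_heegnerField_of_check {W₀ : WeierstrassCurve ℤ} {W : WeierstrassCurve ℚ} [W.IsElliptic]
    (hW : W₀.baseChange ℚ = W) (l : List (ℕ × ℕ)) (hl : ∀ qe ∈ l, qe.1.Prime)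
    (hΔ : W₀.Δ = -(((l.map fun qe => qe.1 ^ qe.2).prod : ℕ) : ℤ) ∨ W₀.Δ = (((l.map fun qe => qe.1 ^ qe.2).prod : ℕ) : ℤ))
    (D : ℤ) (hD : D % 4 = 1 ∧ Squarefree D ∧ D ≠ 1) (hlt : D < -4) (h13 : 13 ∈ l.map Prod.fst)
    (h8 : D % 8 = 1) (hres : ∀ qe ∈ l, qe.1 = 2 ∨ jacobiSym D qe.1 = 1) :
    ∃ (K : Type) (_ : Field K) (_ : NumberField K), IsImaginaryQuadratic K ∧ NumberField.discr K = D ∧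
      SatisfiesHeegnerHypothesis (W.conductorNorm ℤ) K ∧ SatisfiesHeegnerHypothesis 13 K ∧
      Odd (NumberField.discr K) ∧ NumberField.discr K < -4 := by
  obtain ⟨K, _, _, h2, hd⟩ := Quadratic.exists_numberField_discr_eq (D := D) (Or.inl hD)
  have hsplit : ∀ q : ℕ, q.Prime → q ∈ l.map Prod.fst → ((Ideal.span {(q : ℤ)}).primesOver (𝓞 K)).ncard = 2 := by
    intro q hq hmem
    obtain ⟨qe, hqe, rfl⟩ := List.mem_map.mp hmem
    by_cases hq2 : qe.1 = 2
    · rw [hq2]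
      exact (Quadratic.ncard_primesOver_two_eq_two_iff h2).mpr (by rw [hd]; exact h8)
    · exact (Quadratic.ncard_primesOver_eq_two_iff_jacobiSym h2 hq hq2).mpr (by rw [hd]; exact (hres qe hqe).resolve_left hq2)
  refine ⟨K, inferInstance, inferInstance, ⟨h2, Quadratic.isTotallyComplex_of_discr_neg h2 (by rw [hd]; omega)⟩, hd,
    ?_, ?_, ?_, by rw [hd]; exact hlt⟩
  · intro p hp hpN
    have hpΔ := dvd_Δ_of_dvd_conductorNorm _ hW hp hpN
    have hpP : p ∣ ((l.map fun qe => qe.1 ^ qe.2).prod) := by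
      rcases hΔ with h | h <;> rw [h] at hpΔ
      · exact_mod_cast (dvd_neg.mp hpΔ)
      · exact_mod_cast hpΔ
    exact hsplit p hp (mem_of_prime_dvd_prod_pow hp l hl hpP)
  · intro p hp hp13
    have : p = 13 := (Nat.prime_dvd_prime_iff_eq hp (by norm_num)).mp hp13
    subst this
    exact hsplit 13 hp h13
  · rw [hd, Int.odd_iff]; omega

/-! ## §1 SHARPNESS at the twelve A10-type cells at 13 on record (vertex `E`): the least admissible Heegner field exists with `d_K = −B` exactly -/

/-- **Sharpness at cell g19 = −19/13 ⊗ χ₋₄₂ (w6 g19, p745174)** (`N = 504452265408`): a field `K₀` with `d_{K₀} = −335` EXISTS with the Heegner hypothesis for `N_E` and `13`, `d` odd `< −4` (the anchor door's / an edge's field-side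
hypotheses): the door price `d ≤ −335` is attained, cheapest door datum at conductor `N·335² = 5.66e+16`. Kernel: `Δ(E) = −∏ q^e` over `[(2, 6), (3, 6), (7, 10), (13, 13), (19, 1), (269, 3)]`, `(−335 / q) = 1` by `norm_num`. [cite: GrossLMS1991, §1 (p. 235)] -/
theorem exists_heegnerField_discr_eq_e13a10 :
    ∃ (K : Type) (_ : Field K) (_ : NumberField K), IsImaginaryQuadratic K ∧ NumberField.discr K = -335 ∧
      SatisfiesHeegnerHypothesis ((⟨0, 0, 0, 55547317476, 58239761976082638⟩ : WeierstrassCurve ℚ).conductorNorm ℤ) K ∧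
      SatisfiesHeegnerHypothesis 13 K ∧ Odd (NumberField.discr K) ∧ NumberField.discr K < -4 := by
  haveI := EisensteinPrimesMazurMCOnCellBKernelCertP13NoUnitVertex.isElliptic_e13a10
  have hsq : Squarefree (335 : ℕ) := by
    rw [show (335 : ℕ) = 5 * 67 by norm_num]
    exact (Nat.squarefree_mul (by norm_num)).mpr ⟨(by norm_num : Nat.Prime 5).prime.squarefree, (by norm_num : Nat.Prime 67).prime.squarefree⟩
  exact exists_heegnerField_of_check (by have hb := baseChange_mk_int 0 0 0 55547317476 58239761976082638; push_cast at hb; exact hb)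
    [(2, 6), (3, 6), (7, 10), (13, 13), (19, 1), (269, 3)] (by intro qe h; fin_cases h <;> norm_num)
    (Or.inl (by rw [intCurve_Δ]; decide +kernel)) (-335) ⟨by norm_num, by exact_mod_cast Literature.NumberTheory.EllipticCurves.KrizLi2019.squarefree_neg_natCast hsq, by norm_num⟩ (by norm_num)
    (by decide) (by norm_num) (by intro qe h; fin_cases h <;> norm_num)

/-- **Sharpness at cell A = −46/13 ⊗ χ₋₂₇₅₅ (w6 g20, p754117)** (`N = 222402912550`): a field `K₀` with `d_{K₀} = −2159` EXISTS with the Heegner hypothesis for `N_E` and `13`, `d` odd `< −4` (the anchor door's / an edge's field-side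
hypotheses): the door price `d ≤ −2159` is attained, cheapest door datum at conductor `N·2159² = 1.04e+18`. Kernel: `Δ(E) = −∏ q^e` over `[(2, 1), (5, 6), (7, 4), (13, 13), (19, 6), (23, 1), (29, 9)]`, `(−2159 / q) = 1` by `norm_num`. [cite: GrossLMS1991, §1 (p. 235)] -/
theorem exists_heegnerField_discr_eq_e13a11 :
    ∃ (K : Type) (_ : Field K) (_ : NumberField K), IsImaginaryQuadratic K ∧ NumberField.discr K = -2159 ∧
      SatisfiesHeegnerHypothesis ((⟨1, -1, 0, -593429616434692, 5637904708055929338966⟩ : WeierstrassCurve ℚ).conductorNorm ℤ) K ∧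
      SatisfiesHeegnerHypothesis 13 K ∧ Odd (NumberField.discr K) ∧ NumberField.discr K < -4 := by
  haveI := EisensteinPrimesMazurMCOnCellBKernelCertP13PredictedCell.isElliptic_e13a11
  have hsq : Squarefree (2159 : ℕ) := by
    rw [show (2159 : ℕ) = 17 * 127 by norm_num]
    exact (Nat.squarefree_mul (by norm_num)).mpr ⟨(by norm_num : Nat.Prime 17).prime.squarefree, (by norm_num : Nat.Prime 127).prime.squarefree⟩
  exact exists_heegnerField_of_check (by have hb := baseChange_mk_int 1 (-1) 0 (-593429616434692) 5637904708055929338966; push_cast at hb; exact hb)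
    [(2, 1), (5, 6), (7, 4), (13, 13), (19, 6), (23, 1), (29, 9)] (by intro qe h; fin_cases h <;> norm_num)
    (Or.inl (by rw [intCurve_Δ]; decide +kernel)) (-2159) ⟨by norm_num, by exact_mod_cast Literature.NumberTheory.EllipticCurves.KrizLi2019.squarefree_neg_natCast hsq, by norm_num⟩ (by norm_num)
    (by decide) (by norm_num) (by intro qe h; fin_cases h <;> norm_num)

/-- **Sharpness at cell B = −57/13 ⊗ χ₋₁₇₄₁ (w6 g20, p756161)** (`N = 14374598534400`): a field `K₀` with `d_{K₀} = −599` EXISTS with the Heegner hypothesis for `N_E` and `13`, `d` odd `< −4` (the anchor door's / an edge's field-side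
hypotheses): the door price `d ≤ −599` is attained, cheapest door datum at conductor `N·599² = 5.16e+18`. Kernel: `Δ(E) = −∏ q^e` over `[(2, 9), (3, 1), (5, 3), (13, 13), (19, 1), (1741, 8)]`, `(−599 / q) = 1` by `norm_num`. [cite: GrossLMS1991, §1 (p. 235)] -/
theorem exists_heegnerField_discr_eq_e13a12 :
    ∃ (K : Type) (_ : Field K) (_ : NumberField K), IsImaginaryQuadratic K ∧ NumberField.discr K = -599 ∧
      SatisfiesHeegnerHypothesis ((⟨0, 1, 0, -10265161435863023, 400579876938524794946733⟩ : WeierstrassCurve ℚ).conductorNorm ℤ) K ∧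
      SatisfiesHeegnerHypothesis 13 K ∧ Odd (NumberField.discr K) ∧ NumberField.discr K < -4 := by
  haveI := EisensteinPrimesMazurMCOnCellBKernelCertP13ThirdCell.isElliptic_e13a12
  have hsq : Squarefree (599 : ℕ) := (by norm_num : Nat.Prime 599).prime.squarefree
  exact exists_heegnerField_of_check (by have hb := baseChange_mk_int 0 1 0 (-10265161435863023) 400579876938524794946733; push_cast at hb; exact hb)
    [(2, 9), (3, 1), (5, 3), (13, 13), (19, 1), (1741, 8)] (by intro qe h; fin_cases h <;> norm_num)
    (Or.inl (by rw [intCurve_Δ]; decide +kernel)) (-599) ⟨by norm_num, by exact_mod_cast Literature.NumberTheory.EllipticCurves.KrizLi2019.squarefree_neg_natCast hsq, by norm_num⟩ (by norm_num)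
    (by decide) (by norm_num) (by intro qe h; fin_cases h <;> norm_num)

/-- **Sharpness at cell C = −46/13 ⊗ χ₋₂₂₈₉ (w6 g20, p756413)** (`N = 21080395378224`): a field `K₀` with `d_{K₀} = −2159` EXISTS with the Heegner hypothesis for `N_E` and `13`, `d` odd `< −4` (the anchor door's / an edge's field-side
hypotheses): the door price `d ≤ −2159` is attained, cheapest door datum at conductor `N·2159² = 9.83e+19`. Kernel: `Δ(E) = −∏ q^e` over `[(2, 13), (3, 6), (7, 10), (13, 13), (23, 1), (29, 3), (109, 6)]`, `(−2159 / q) = 1` by `norm_num`. [cite: GrossLMS1991, §1 (p. 235)] -/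
theorem exists_heegnerField_discr_eq_e13a13 :
    ∃ (K : Type) (_ : Field K) (_ : NumberField K), IsImaginaryQuadratic K ∧ NumberField.discr K = -2159 ∧
      SatisfiesHeegnerHypothesis ((⟨0, 0, 0, -6554469978333963, 206952302283565583167290⟩ : WeierstrassCurve ℚ).conductorNorm ℤ) K ∧
      SatisfiesHeegnerHypothesis 13 K ∧ Odd (NumberField.discr K) ∧ NumberField.discr K < -4 := by
  haveI := EisensteinPrimesMazurMCOnCellBKernelCertP13FourthCell.isElliptic_e13a13
  have hsq : Squarefree (2159 : ℕ) := by
    rw [show (2159 : ℕ) = 17 * 127 by norm_num]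
    exact (Nat.squarefree_mul (by norm_num)).mpr ⟨(by norm_num : Nat.Prime 17).prime.squarefree, (by norm_num : Nat.Prime 127).prime.squarefree⟩
  exact exists_heegnerField_of_check (by have hb := baseChange_mk_int 0 0 0 (-6554469978333963) 206952302283565583167290; push_cast at hb; exact hb)
    [(2, 13), (3, 6), (7, 10), (13, 13), (23, 1), (29, 3), (109, 6)] (by intro qe h; fin_cases h <;> norm_num)
    (Or.inl (by rw [intCurve_Δ]; decide +kernel)) (-2159) ⟨by norm_num, by exact_mod_cast Literature.NumberTheory.EllipticCurves.KrizLi2019.squarefree_neg_natCast hsq, by norm_num⟩ (by norm_num)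
    (by decide) (by norm_num) (by intro qe h; fin_cases h <;> norm_num)

/-- **Sharpness at cell D = −46/13 ⊗ χ₋₂₅₃₄ (w6 g20, p757375)** (`N = 25834519465664`): a field `K₀` with `d_{K₀} = −1095` EXISTS with the Heegner hypothesis for `N_E` and `13`, `d` odd `< −4` (the anchor door's / an edge's field-side
hypotheses): the door price `d ≤ −1095` is attained, cheapest door datum at conductor `N·1095² = 3.1e+19`. Kernel: `Δ(E) = −∏ q^e` over `[(2, 19), (7, 10), (13, 13), (23, 1), (29, 3), (181, 6)]`, `(−1095 / q) = 1` by `norm_num`. [cite: GrossLMS1991, §1 (p. 235)] -/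
theorem exists_heegnerField_discr_eq_e13a14 :
    ∃ (K : Type) (_ : Field K) (_ : NumberField K), IsImaginaryQuadratic K ∧ NumberField.discr K = -1095 ∧
      SatisfiesHeegnerHypothesis ((⟨0, 0, 0, -8032656845577868, 280771301908554992678640⟩ : WeierstrassCurve ℚ).conductorNorm ℤ) K ∧
      SatisfiesHeegnerHypothesis 13 K ∧ Odd (NumberField.discr K) ∧ NumberField.discr K < -4 := by
  haveI := EisensteinPrimesMazurMCOnCellBKernelCertP13FifthCell.isElliptic_e13a14
  have hsq : Squarefree (1095 : ℕ) := by
    rw [show (1095 : ℕ) = 3 * (5 * 73) by norm_num]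
    exact (Nat.squarefree_mul (by norm_num)).mpr ⟨(by norm_num : Nat.Prime 3).prime.squarefree, (Nat.squarefree_mul (by norm_num)).mpr ⟨(by norm_num : Nat.Prime 5).prime.squarefree, (by norm_num : Nat.Prime 73).prime.squarefree⟩⟩
  exact exists_heegnerField_of_check (by have hb := baseChange_mk_int 0 0 0 (-8032656845577868) 280771301908554992678640; push_cast at hb; exact hb)
    [(2, 19), (7, 10), (13, 13), (23, 1), (29, 3), (181, 6)] (by intro qe h; fin_cases h <;> norm_num)
    (Or.inl (by rw [intCurve_Δ]; decide +kernel)) (-1095) ⟨by norm_num, by exact_mod_cast Literature.NumberTheory.EllipticCurves.KrizLi2019.squarefree_neg_natCast hsq, by norm_num⟩ (by norm_num)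
    (by decide) (by norm_num) (by intro qe h; fin_cases h <;> norm_num)

/-- **Sharpness at cell S = −46/13 ⊗ χ₋₁₇₁₁, 13 SPLIT (w6 g20, p757194)** (`N = 85782220342`): a field `K₀` with `d_{K₀} = −103` EXISTS with the Heegner hypothesis for `N_E` and `13`, `d` odd `< −4` (the anchor door's / an edge's field-side
hypotheses): the door price `d ≤ −103` is attained, cheapest door datum at conductor `N·103² = 9.1e+14`. Kernel: `Δ(E) = −∏ q^e` over `[(2, 1), (7, 4), (13, 13), (23, 1), (29, 9), (59, 6)]`, `(−103 / q) = 1` by `norm_num`. [cite: GrossLMS1991, §1 (p. 235)] -/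
theorem exists_heegnerField_discr_eq_e13a15 :
    ∃ (K : Type) (_ : Field K) (_ : NumberField K), IsImaginaryQuadratic K ∧ NumberField.discr K = -103 ∧
      SatisfiesHeegnerHypothesis ((⟨1, -1, 1, -228889583912373, 1350526023767167417979⟩ : WeierstrassCurve ℚ).conductorNorm ℤ) K ∧
      SatisfiesHeegnerHypothesis 13 K ∧ Odd (NumberField.discr K) ∧ NumberField.discr K < -4 := by
  haveI := EisensteinPrimesMazurMCOnCellBKernelCertP13SplitA10Cell.isElliptic_e13a15
  have hsq : Squarefree (103 : ℕ) := (by norm_num : Nat.Prime 103).prime.squarefree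
  exact exists_heegnerField_of_check (by have hb := baseChange_mk_int 1 (-1) 1 (-228889583912373) 1350526023767167417979; push_cast at hb; exact hb)
    [(2, 1), (7, 4), (13, 13), (23, 1), (29, 9), (59, 6)] (by intro qe h; fin_cases h <;> norm_num)
    (Or.inl (by rw [intCurve_Δ]; decide +kernel)) (-103) ⟨by norm_num, by exact_mod_cast Literature.NumberTheory.EllipticCurves.KrizLi2019.squarefree_neg_natCast hsq, by norm_num⟩ (by norm_num)
    (by decide) (by norm_num) (by intro qe h; fin_cases h <;> norm_num)

/-- **Sharpness at cell I = −32/13 ⊗ χ₋₁₄₇₉ (w6 g20, p759720)** (`N = 74042484789546`): a field `K₀` with `d_{K₀} = −1223` EXISTS with the Heegner hypothesis for `N_E` and `13`, `d` odd `< −4` (the anchor door's / an edge's field-side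
hypotheses): the door price `d ≤ −1223` is attained, cheapest door datum at conductor `N·1223² = 1.11e+20`. Kernel: `Δ(E) = −∏ q^e` over `[(2, 5), (3, 6), (7, 2), (13, 13), (17, 6), (29, 9), (163, 2)]`, `(−1223 / q) = 1` by `norm_num`. [cite: GrossLMS1991, §1 (p. 235)] -/
theorem exists_heegnerField_discr_eq_e13a16 :
    ∃ (K : Type) (_ : Field K) (_ : NumberField K), IsImaginaryQuadratic K ∧ NumberField.discr K = -1223 ∧
      SatisfiesHeegnerHypothesis ((⟨1, -1, 1, -332636942380889, 3592856931198596701273⟩ : WeierstrassCurve ℚ).conductorNorm ℤ) K ∧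
      SatisfiesHeegnerHypothesis 13 K ∧ Odd (NumberField.discr K) ∧ NumberField.discr K < -4 := by
  haveI := EisensteinPrimesMazurMCOnCellBKernelCertP13InertCell.isElliptic_e13a16
  have hsq : Squarefree (1223 : ℕ) := (by norm_num : Nat.Prime 1223).prime.squarefree
  exact exists_heegnerField_of_check (by have hb := baseChange_mk_int 1 (-1) 1 (-332636942380889) 3592856931198596701273; push_cast at hb; exact hb)
    [(2, 5), (3, 6), (7, 2), (13, 13), (17, 6), (29, 9), (163, 2)] (by intro qe h; fin_cases h <;> norm_num)
    (Or.inl (by rw [intCurve_Δ]; decide +kernel)) (-1223) ⟨by norm_num, by exact_mod_cast Literature.NumberTheory.EllipticCurves.KrizLi2019.squarefree_neg_natCast hsq, by norm_num⟩ (by norm_num)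
    (by decide) (by norm_num) (by intro qe h; fin_cases h <;> norm_num)

/-- **Sharpness at cell T = −46/13 ⊗ χ₋₆₈₁₅ (A10 #10, w6 g21)** (`N = 1360908680950`): a field `K₀` with `d_{K₀} = −199` EXISTS with the Heegner hypothesis for `N_E` and `13`, `d` odd `< −4` (the anchor door's / an edge's field-side
hypotheses): the door price `d ≤ −199` is attained, cheapest door datum at conductor `N·199² = 5.39e+16`. Kernel: `Δ(E) = −∏ q^e` over `[(2, 1), (5, 6), (7, 4), (13, 13), (23, 1), (29, 9), (47, 6)]`, `(−199 / q) = 1` by `norm_num`. [cite: GrossLMS1991, §1 (p. 235)] -/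
theorem exists_heegnerField_discr_eq_e13a17 :
    ∃ (K : Type) (_ : Field K) (_ : NumberField K), IsImaginaryQuadratic K ∧ NumberField.discr K = -199 ∧
      SatisfiesHeegnerHypothesis ((⟨1, -1, 1, -3631263220787355, 85339578849437030591897⟩ : WeierstrassCurve ℚ).conductorNorm ℤ) K ∧
      SatisfiesHeegnerHypothesis 13 K ∧ Odd (NumberField.discr K) ∧ NumberField.discr K < -4 := by
  haveI := EisensteinPrimesMazurMCOnCellBKernelCertP13TenthCell.isElliptic_e13a17
  have hsq : Squarefree (199 : ℕ) := (by norm_num : Nat.Prime 199).prime.squarefree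
  exact exists_heegnerField_of_check (by have hb := baseChange_mk_int 1 (-1) 1 (-3631263220787355) 85339578849437030591897; push_cast at hb; exact hb)
    [(2, 1), (5, 6), (7, 4), (13, 13), (23, 1), (29, 9), (47, 6)] (by intro qe h; fin_cases h <;> norm_num)
    (Or.inl (by rw [intCurve_Δ]; decide +kernel)) (-199) ⟨by norm_num, by exact_mod_cast Literature.NumberTheory.EllipticCurves.KrizLi2019.squarefree_neg_natCast hsq, by norm_num⟩ (by norm_num)
    (by decide) (by norm_num) (by intro qe h; fin_cases h <;> norm_num)

/-- **Sharpness at cell U = −46/13 ⊗ χ₋₄₅₀₁ (A10 #11, Ш_an = 13²·3², w6 g21)** (`N = 81508930119344`): a field `K₀` with `d_{K₀} = −103` EXISTS with the Heegner hypothesis for `N_E` and `13`, `d` odd `< −4` (the anchor door's / an edge's field-side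
hypotheses): the door price `d ≤ −103` is attained, cheapest door datum at conductor `N·103² = 8.65e+17`. Kernel: `Δ(E) = −∏ q^e` over `[(2, 13), (7, 10), (13, 13), (23, 1), (29, 3), (643, 6)]`, `(−103 / q) = 1` by `norm_num`. [cite: GrossLMS1991, §1 (p. 235)] -/
theorem exists_heegnerField_discr_eq_e13a18 :
    ∃ (K : Type) (_ : Field K) (_ : NumberField K), IsImaginaryQuadratic K ∧ NumberField.discr K = -103 ∧
      SatisfiesHeegnerHypothesis ((⟨0, 0, 0, -25343349868344403, 1573475274969726091051410⟩ : WeierstrassCurve ℚ).conductorNorm ℤ) K ∧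
      SatisfiesHeegnerHypothesis 13 K ∧ Odd (NumberField.discr K) ∧ NumberField.discr K < -4 := by
  haveI := EisensteinPrimesMazurMCOnCellBKernelCertP13EleventhCell.isElliptic_e13a18
  have hsq : Squarefree (103 : ℕ) := (by norm_num : Nat.Prime 103).prime.squarefree
  exact exists_heegnerField_of_check (by have hb := baseChange_mk_int 0 0 0 (-25343349868344403) 1573475274969726091051410; push_cast at hb; exact hb)
    [(2, 13), (7, 10), (13, 13), (23, 1), (29, 3), (643, 6)] (by intro qe h; fin_cases h <;> norm_num)
    (Or.inl (by rw [intCurve_Δ]; decide +kernel)) (-103) ⟨by norm_num, by exact_mod_cast Literature.NumberTheory.EllipticCurves.KrizLi2019.squarefree_neg_natCast hsq, by norm_num⟩ (by norm_num)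
    (by decide) (by norm_num) (by intro qe h; fin_cases h <;> norm_num)

/-- **Sharpness at cell V = −46/13 ⊗ χ₋₁₅₈₃ (g20 #7, file w6 g21)** (`N = 61752577520998`): a field `K₀` with `d_{K₀} = −103` EXISTS with the Heegner hypothesis for `N_E` and `13`, `d` odd `< −4` (the anchor door's / an edge's field-side
hypotheses): the door price `d ≤ −103` is attained, cheapest door datum at conductor `N·103² = 6.55e+17`. Kernel: `Δ(E) = −∏ q^e` over `[(2, 1), (7, 4), (13, 13), (23, 1), (29, 3), (1583, 6)]`, `(−103 / q) = 1` by `norm_num`. [cite: GrossLMS1991, §1 (p. 235)] -/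
theorem exists_heegnerField_discr_eq_e13a19 :
    ∃ (K : Type) (_ : Field K) (_ : NumberField K), IsImaginaryQuadratic K ∧ NumberField.discr K = -103 ∧
      SatisfiesHeegnerHypothesis ((⟨1, -1, 1, -195924090908517, 1069536658430224254155⟩ : WeierstrassCurve ℚ).conductorNorm ℤ) K ∧
      SatisfiesHeegnerHypothesis 13 K ∧ Odd (NumberField.discr K) ∧ NumberField.discr K < -4 := by
  haveI := EisensteinPrimesMazurMCOnCellBKernelCertP13SeventhCell.isElliptic_e13a19
  have hsq : Squarefree (103 : ℕ) := (by norm_num : Nat.Prime 103).prime.squarefree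
  exact exists_heegnerField_of_check (by have hb := baseChange_mk_int 1 (-1) 1 (-195924090908517) 1069536658430224254155; push_cast at hb; exact hb)
    [(2, 1), (7, 4), (13, 13), (23, 1), (29, 3), (1583, 6)] (by intro qe h; fin_cases h <;> norm_num)
    (Or.inl (by rw [intCurve_Δ]; decide +kernel)) (-103) ⟨by norm_num, by exact_mod_cast Literature.NumberTheory.EllipticCurves.KrizLi2019.squarefree_neg_natCast hsq, by norm_num⟩ (by norm_num)
    (by decide) (by norm_num) (by intro qe h; fin_cases h <;> norm_num)

/-- **Sharpness at cell W = −46/13 ⊗ χ₋₂₆₇₉ (g20 #9, file w6 g21)** (`N = 176863692176262`): a field `K₀` with `d_{K₀} = −2159` EXISTS with the Heegner hypothesis for `N_E` and `13`, `d` odd `< −4` (the anchor door's / an edge's field-side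
hypotheses): the door price `d ≤ −2159` is attained, cheapest door datum at conductor `N·2159² = 8.24e+20`. Kernel: `Δ(E) = −∏ q^e` over `[(2, 1), (3, 6), (7, 4), (13, 13), (19, 6), (23, 1), (29, 3), (47, 6)]`, `(−2159 / q) = 1` by `norm_num`. [cite: GrossLMS1991, §1 (p. 235)] -/
theorem exists_heegnerField_discr_eq_e13a20 :
    ∃ (K : Type) (_ : Field K) (_ : NumberField K), IsImaginaryQuadratic K ∧ NumberField.discr K = -2159 ∧
      SatisfiesHeegnerHypothesis ((⟨1, -1, 1, -561140271312158, 5184072454112665382539⟩ : WeierstrassCurve ℚ).conductorNorm ℤ) K ∧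
      SatisfiesHeegnerHypothesis 13 K ∧ Odd (NumberField.discr K) ∧ NumberField.discr K < -4 := by
  haveI := EisensteinPrimesMazurMCOnCellBKernelCertP13NinthCell.isElliptic_e13a20
  have hsq : Squarefree (2159 : ℕ) := by
    rw [show (2159 : ℕ) = 17 * 127 by norm_num]
    exact (Nat.squarefree_mul (by norm_num)).mpr ⟨(by norm_num : Nat.Prime 17).prime.squarefree, (by norm_num : Nat.Prime 127).prime.squarefree⟩
  exact exists_heegnerField_of_check (by have hb := baseChange_mk_int 1 (-1) 1 (-561140271312158) 5184072454112665382539; push_cast at hb; exact hb)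
    [(2, 1), (3, 6), (7, 4), (13, 13), (19, 6), (23, 1), (29, 3), (47, 6)] (by intro qe h; fin_cases h <;> norm_num)
    (Or.inl (by rw [intCurve_Δ]; decide +kernel)) (-2159) ⟨by norm_num, by exact_mod_cast Literature.NumberTheory.EllipticCurves.KrizLi2019.squarefree_neg_natCast hsq, by norm_num⟩ (by norm_num)
    (by decide) (by norm_num) (by intro qe h; fin_cases h <;> norm_num)

/-- **Sharpness at cell X = −46/13 ⊗ χ₋₃₉₆₂ (A10 #12, w6 g21)** (`N = 63156217132736`): a field `K₀` with `d_{K₀} = −1167` EXISTS with the Heegner hypothesis for `N_E` and `13`, `d` odd `< −4` (the anchor door's / an edge's field-side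
hypotheses): the door price `d ≤ −1167` is attained, cheapest door datum at conductor `N·1167² = 8.6e+19`. Kernel: `Δ(E) = −∏ q^e` over `[(2, 19), (7, 10), (13, 13), (23, 1), (29, 3), (283, 6)]`, `(−1167 / q) = 1` by `norm_num`. [cite: GrossLMS1991, §1 (p. 235)] -/
theorem exists_heegnerField_discr_eq_e13a21 :
    ∃ (K : Type) (_ : Field K) (_ : NumberField K), IsImaginaryQuadratic K ∧ NumberField.discr K = -1167 ∧
      SatisfiesHeegnerHypothesis ((⟨0, 0, 0, -19636990754417932, 1073189210454698748030480⟩ : WeierstrassCurve ℚ).conductorNorm ℤ) K ∧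
      SatisfiesHeegnerHypothesis 13 K ∧ Odd (NumberField.discr K) ∧ NumberField.discr K < -4 := by
  haveI := EisensteinPrimesMazurMCOnCellBKernelCertP13TwelfthCell.isElliptic_e13a21
  have hsq : Squarefree (1167 : ℕ) := by
    rw [show (1167 : ℕ) = 3 * 389 by norm_num]
    exact (Nat.squarefree_mul (by norm_num)).mpr ⟨(by norm_num : Nat.Prime 3).prime.squarefree, (by norm_num : Nat.Prime 389).prime.squarefree⟩
  exact exists_heegnerField_of_check (by have hb := baseChange_mk_int 0 0 0 (-19636990754417932) 1073189210454698748030480; push_cast at hb; exact hb)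
    [(2, 19), (7, 10), (13, 13), (23, 1), (29, 3), (283, 6)] (by intro qe h; fin_cases h <;> norm_num)
    (Or.inl (by rw [intCurve_Δ]; decide +kernel)) (-1167) ⟨by norm_num, by exact_mod_cast Literature.NumberTheory.EllipticCurves.KrizLi2019.squarefree_neg_natCast hsq, by norm_num⟩ (by norm_num)
    (by decide) (by norm_num) (by intro qe h; fin_cases h <;> norm_num)

/-- **Sharpness at cell Y = −46/13 ⊗ χ₋₉₈₃₁ (A10 #13, w6 g21)** (`N = 2831996134422`): a field `K₀` with `d_{K₀} = −2495` EXISTS with the Heegner hypothesis for `N_E` and `13`, `d` odd `< −4` (the anchor door's / an edge's field-side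
hypotheses): the door price `d ≤ −2495` is attained, cheapest door datum at conductor `N·2495² = 1.76e+19`. Kernel: `Δ(E) = −∏ q^e` over `[(2, 1), (3, 6), (7, 4), (13, 13), (23, 1), (29, 9), (113, 6)]`, `(−2495 / q) = 1` by `norm_num`. [cite: GrossLMS1991, §1 (p. 235)] -/
theorem exists_heegnerField_discr_eq_e13a22 :
    ∃ (K : Type) (_ : Field K) (_ : NumberField K), IsImaginaryQuadratic K ∧ NumberField.discr K = -2495 ∧
      SatisfiesHeegnerHypothesis ((⟨1, -1, 1, -7556512459866068, 256180460309112042534709⟩ : WeierstrassCurve ℚ).conductorNorm ℤ) K ∧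
      SatisfiesHeegnerHypothesis 13 K ∧ Odd (NumberField.discr K) ∧ NumberField.discr K < -4 := by
  haveI := EisensteinPrimesMazurMCOnCellBKernelCertP13ThirteenthCell.isElliptic_e13a22
  have hsq : Squarefree (2495 : ℕ) := by
    rw [show (2495 : ℕ) = 5 * 499 by norm_num]
    exact (Nat.squarefree_mul (by norm_num)).mpr ⟨(by norm_num : Nat.Prime 5).prime.squarefree, (by norm_num : Nat.Prime 499).prime.squarefree⟩
  exact exists_heegnerField_of_check (by have hb := baseChange_mk_int 1 (-1) 1 (-7556512459866068) 256180460309112042534709; push_cast at hb; exact hb)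
    [(2, 1), (3, 6), (7, 4), (13, 13), (23, 1), (29, 9), (113, 6)] (by intro qe h; fin_cases h <;> norm_num)
    (Or.inl (by rw [intCurve_Δ]; decide +kernel)) (-2495) ⟨by norm_num, by exact_mod_cast Literature.NumberTheory.EllipticCurves.KrizLi2019.squarefree_neg_natCast hsq, by norm_num⟩ (by norm_num)
    (by decide) (by norm_num) (by intro qe h; fin_cases h <;> norm_num)

end Summit.BirchSwinnertonDyer.BirchSwinnertonDyer.Theorems.EisensteinPrimesMazurMCOnCellBKernelCertP13DoorPriceSharp
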